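import Summits.NavierStokesRegularity.OSWSelfSimilar.CertificateViscousSheetR
import Literature.Analysis.OperatorTheory.CoerciveFiniteRankNewtonKantorovich
import Literature.Analysis.Calculus.QuadraticMapKantorovich
import HarnessLib

/-!
# Z3-SR-CERT: the row's sentence from the row's literals and the abstract kernel chain (C1)–(C4)

HONEST FRAMING (cell ns-blowup GROUP B, zone Z3, case Z3-SR-CERT; PROFILE-SPEC v1.3; profile-lead RULINGS (ay)/(ca)): **1-D MODEL
(viscous gCLM/OSW sheet on `ℝ` at `c_l = 1/2`), computer-assisted; not Euler, not Navier–Stokes; «violates: none — MODEL»; census hook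
`Literature.Analysis.FluidPDE.effectiveViscosity_half`.**  Companion of the row file `CertificateViscousSheetR.lean` (implementation 1,
seat profile-cert-1; literals `cLam, epsN, KNw, KNstar, K, Llip, eta, h, rE, rSup` and the `norm_num` facts `K_ge, h_ge, h_lt_half, rE_ge`)
and of the abstract chain `Literature.Analysis.OperatorTheory.CoerciveFiniteRankNewtonKantorovich` (seat profile-cert-2 g4).

WHAT THIS FILE PROVES (`existsUnique_zero_of_row`): for ANY real Hilbert space `E` (the energy space), pivot inner-product space `W`,
map `G : E → E*` with derivative `G'`, and data `(S, f, ℓ, N, z, a, J, R)` satisfying the hypotheses of the abstract chain — `S` the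
two-sided inverse of the coercive part `B` with `‖S φ‖ ≤ K₁‖φ‖`; `N` the capacitance inverse of the finite-rank part `∑ ℓᵢ(·) fᵢ`;
adjoint solves `zⱼ` (`B v zⱼ = ℓⱼ v`) with Gram-pencil bound `Λ_E`; pivot representers `aⱼ` (`ℓⱼ(S (J g)) = ⟪aⱼ, g⟫`) with bound `Λ_W`
and `‖S (J g)‖ ≤ K₂‖g‖`; remainder `‖R u‖ ≤ ε‖u‖`; splitting `G' x̄ u = B u − ∑ ℓᵢ(u) fᵢ − J (R u)`; `‖G' x − G' x̄‖ ≤ L‖x − x̄‖` — whose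
constants are BOUNDED BY THE ROW'S LITERALS (`K₁ + √Λ_E ≤ KNstar`, `K₂ + √Λ_W ≤ KNw`, `ε ≤ epsN`, `L ≤ Llip`, `‖G x̄‖ ≤ eta`), the closed
`E`-ball of radius `rE = 1.189e-5` (the row's literal) about `x̄` contains EXACTLY ONE zero of `G`.  Kernel steps: the chain's inverse bound
`(K₁ + √Λ_E)/(1 − (K₂ + √Λ_W) ε) ≤ KNstar/(1 − KNw·epsN) ≤ K` (`K_ge`), `2K²Lη ≤ 2h < 1` (`h_ge`, `h_lt_half`),
`(1 − √(1 − 2K²Lη))/(KL) ≤ 2Kη ≤ rE` (`kantorovich_radius_le`, `rE_ge`), and the uniqueness window `rE < 1/(K·Llip)` (`rE_mul_K_mul_Llip_lt_one`,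
new here), fed into `existsUnique_zero_of_kantorovich_window`.

WHAT IS (STILL) NOT KERNEL-CHECKED, and is therefore a HYPOTHESIS of the theorem: (i) that implementation 1's interval arithmetic establishes the
bounds with these literals; (ii) the MODEL ASSEMBLY — that the sheet's `B_λ` (coercive by the backbone identity `SheetLineBackbone.backbone_energy_identity`
+ the potential bound (C1)), the Cayley frame `eᵢ` and functionals `ℓᵢ = ⟨P ·, eᵢ⟩_w/(2L³π)` ((E1)/(E2)), the adjoint right-hand sides `P†eⱼ`,
the `w`-pairing `J` and the high-pass remainder `Π_T P` ((E5): `SheetRHighPass`) instantiate `(B, S, f, ℓ, N, z, a, J, R)`.  No definition,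
no `Prop` fact, no number or word of the cell changes.  WHAT THIS IS NOT: not NS.
-/

noncomputable section

open Metric Set Matrix Finset
open scoped BigOperators

namespace Summit.NavierStokesRegularity.OSWSelfSimilar
namespace CertificateViscousSheetR

open Literature.Analysis.OperatorTheory Literature.Analysis.Calculus

/-- The uniqueness window closes on the printed literals: `rE · K · Llip < 1` (so `rE < 1/(K·L)` for every `L ≤ Llip`). [folklore] -/
theorem rE_mul_K_mul_Llip_lt_one : rE * K * Llip < 1 := by norm_num [rE, K, Llip]

/-- The printed literals are positive / the discriminant literal is nonnegative (bookkeeping for the casts). [folklore] -/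
theorem K_pos_and_Llip_pos : 0 < K ∧ 0 < Llip ∧ 0 ≤ eta ∧ 0 ≤ epsN ∧ 0 ≤ KNw := by
  refine ⟨?_, ?_, ?_, ?_, ?_⟩ <;> norm_num [K, Llip, eta, epsN, KNw]

variable {E : Type*} [NormedAddCommGroup E] [InnerProductSpace ℝ E] [CompleteSpace E]
variable {W : Type*} [NormedAddCommGroup W] [InnerProductSpace ℝ W]
variable {ι : Type*} [Fintype ι] [DecidableEq ι]

/-- **The row's sentence, kernel-composed.**  For any energy space `E`, pivot space `W` and data as in the abstract chain
`existsUnique_zero_of_coercive_finiteRank_chain`, with constants bounded by the row literals of `CertificateViscousSheetR`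
(`K₁ + √Λ_E ≤ KNstar`, `K₂ + √Λ_W ≤ KNw`, `ε ≤ epsN`, `L ≤ Llip`, `‖G x̄‖ ≤ eta`): the closed `E`-ball of radius `rE` about `x̄`
contains exactly one zero of `G`.  (MODEL; the instantiation of the data by the sheet's operators and implementation 1's interval
arithmetic are the hypotheses — see the module docstring.) [folklore] -/
theorem existsUnique_zero_of_row {G : E → StrongDual ℝ E} {G' : E → E →L[ℝ] StrongDual ℝ E} {xbar : E}
    (hG : ∀ x, HasFDerivAt G (G' x) x)
    {B : E →L[ℝ] E →L[ℝ] ℝ}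
    (S : StrongDual ℝ E →L[ℝ] E) (hBS : ∀ φ, B (S φ) = φ) (hSB : ∀ u, S (B u) = u)
    {Kone : ℝ} (hS : ∀ φ, ‖S φ‖ ≤ Kone * ‖φ‖)
    (f : ι → StrongDual ℝ E) (ℓ : ι → E →L[ℝ] ℝ) (Ncap : Matrix ι ι ℝ)
    (hN₁ : (1 - capMatrix f (fun i => (ℓ i).comp S)) * Ncap = 1)
    (hN₂ : Ncap * (1 - capMatrix f (fun i => (ℓ i).comp S)) = 1)
    (z : ι → E) (hz : ∀ j u, B u (z j) = ℓ j u) {ΛE : ℝ} (hΛE : 0 ≤ ΛE)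
    (hpE : ∀ w : ι → ℝ, ‖∑ i, (Ncap *ᵥ (Matrix.gram ℝ z *ᵥ w)) i • S (f i)‖ ^ 2 ≤
      ΛE * (w ⬝ᵥ (Matrix.gram ℝ z *ᵥ w)))
    (J : W →L[ℝ] StrongDual ℝ E) {Ktwo : ℝ} (hSJ : ∀ g, ‖S (J g)‖ ≤ Ktwo * ‖g‖) (hKtwo : 0 ≤ Ktwo)
    (arep : ι → W) (ha : ∀ j g, ℓ j (S (J g)) = inner ℝ (arep j) g) {ΛW : ℝ} (hΛW : 0 ≤ ΛW)
    (hpW : ∀ w : ι → ℝ, ‖∑ i, (Ncap *ᵥ (Matrix.gram ℝ arep *ᵥ w)) i • S (f i)‖ ^ 2 ≤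
      ΛW * (w ⬝ᵥ (Matrix.gram ℝ arep *ᵥ w)))
    (R : E →L[ℝ] W) {ε : ℝ} (hR : ∀ u, ‖R u‖ ≤ ε * ‖u‖) (hε : 0 ≤ ε)
    (hD : ∀ u, G' xbar u = B u - ∑ i, ℓ i u • f i - J (R u))
    {Lip : ℝ} (hL : ∀ x, ‖G' x - G' xbar‖ ≤ Lip * ‖x - xbar‖) (hLpos : 0 < Lip)
    -- the bounds by the row's literals
    (hKNstar : Kone + Real.sqrt ΛE ≤ (KNstar : ℝ)) (hKNw : Ktwo + Real.sqrt ΛW ≤ (KNw : ℝ))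
    (hεN : ε ≤ (epsN : ℝ)) (hLlip : Lip ≤ (Llip : ℝ)) (hη : ‖G xbar‖ ≤ (eta : ℝ)) :
    ∃ x ∈ closedBall xbar (rE : ℝ), G x = 0 ∧ ∀ y ∈ closedBall xbar (rE : ℝ), G y = 0 → y = x := by
  obtain ⟨hKpos, hLlippos, heta0, hepsN0, hKNw0⟩ := K_pos_and_Llip_pos
  have hKposR : (0 : ℝ) < (K : ℝ) := by exact_mod_cast hKpos
  have hLlipR : (0 : ℝ) < (Llip : ℝ) := by exact_mod_cast hLlippos
  have hetaR : (0 : ℝ) ≤ (eta : ℝ) := by exact_mod_cast heta0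
  have hepsNR : (0 : ℝ) ≤ (epsN : ℝ) := by exact_mod_cast hepsN0
  -- the row's closing inequalities, cast to `ℝ`
  have hKge : ((KNstar : ℚ) : ℝ) / (1 - (KNw : ℝ) * (epsN : ℝ)) ≤ (K : ℝ) := by
    have h := K_ge; exact_mod_cast h
  have hKe1 : (KNw : ℝ) * (epsN : ℝ) < 1 := by
    have h := KNw_mul_epsN_lt_one; exact_mod_cast h
  have hhge : (K : ℝ) ^ 2 * (Llip : ℝ) * (eta : ℝ) ≤ (h : ℝ) := by
    have h' := h_ge; exact_mod_cast h'
  have hhlt : 2 * ((h : ℚ) : ℝ) < 1 := by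
    have h' : 2 * h < 1 := by have := h_lt_half; linarith
    exact_mod_cast h'
  have hrEge : 2 * (K : ℝ) * (eta : ℝ) ≤ (rE : ℝ) := by
    have h' := rE_ge; exact_mod_cast h'
  have hwin : (rE : ℝ) * (K : ℝ) * (Llip : ℝ) < 1 := by
    have h' := rE_mul_K_mul_Llip_lt_one; exact_mod_cast h'
  -- (C1)–(C3): the exact inverse of `G' x̄` with the chain's bound
  have hKNw0R : (0 : ℝ) ≤ (KNw : ℝ) := by exact_mod_cast hKNw0
  have hprod : (Ktwo + Real.sqrt ΛW) * ε ≤ (KNw : ℝ) * (epsN : ℝ) := mul_le_mul hKNw hεN hε hKNw0R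
  have hKw0 : 0 ≤ Ktwo + Real.sqrt ΛW := add_nonneg hKtwo (Real.sqrt_nonneg _)
  have hsmall : (Ktwo + Real.sqrt ΛW) * ε < 1 := hprod.trans_lt hKe1
  obtain ⟨T, hDT, hTD, hT⟩ := exists_inverse_of_coercive_finiteRank_chain S hBS hSB hS f ℓ Ncap hN₁ hN₂ z hz
    hΛE hpE J hSJ arep ha hΛW hpW R hR hε hKtwo hsmall (G' xbar) hD
  -- the chain's constant is dominated by the printed `K`
  have hden : 0 < 1 - (Ktwo + Real.sqrt ΛW) * ε := by linarith
  have hdenN : 0 < 1 - (KNw : ℝ) * (epsN : ℝ) := by linarith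
  have hKcK : (Kone + Real.sqrt ΛE) / (1 - (Ktwo + Real.sqrt ΛW) * ε) ≤ (K : ℝ) := by
    by_cases hnum : 0 ≤ Kone + Real.sqrt ΛE
    · have hKNstar0 : (0 : ℝ) ≤ (KNstar : ℝ) := hnum.trans hKNstar
      calc (Kone + Real.sqrt ΛE) / (1 - (Ktwo + Real.sqrt ΛW) * ε)
          ≤ (KNstar : ℝ) / (1 - (KNw : ℝ) * (epsN : ℝ)) :=
            div_le_div₀ hKNstar0 hKNstar hdenN (by linarith)
        _ ≤ (K : ℝ) := hKge
    · have hnum' : Kone + Real.sqrt ΛE < 0 := lt_of_not_ge hnum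
      exact (div_neg_of_neg_of_pos hnum' hden).le.trans hKposR.le
  have hTK : ∀ φ, ‖T φ‖ ≤ (K : ℝ) * ‖φ‖ := fun φ =>
    (hT φ).trans (mul_le_mul_of_nonneg_right hKcK (norm_nonneg _))
  -- the exact inverse as a continuous linear equivalence
  set Φ : E ≃L[ℝ] StrongDual ℝ E :=
    ContinuousLinearEquiv.equivOfInverse (G' xbar) T (fun u => hTD u) (fun φ => hDT φ) with hΦ
  have hΦeq : (Φ : E →L[ℝ] StrongDual ℝ E) = G' xbar := by
    ext u v; rfl
  have hKΦ : ‖(Φ.symm : StrongDual ℝ E →L[ℝ] E)‖ ≤ (K : ℝ) := by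
    refine ContinuousLinearMap.opNorm_le_bound _ hKposR.le fun φ => ?_
    exact hTK φ
  -- (C4): discriminant, radius and window on the printed literals
  have hKLe : (K : ℝ) ^ 2 * Lip * (eta : ℝ) ≤ (K : ℝ) ^ 2 * (Llip : ℝ) * (eta : ℝ) := by
    have hK2 : (0 : ℝ) ≤ (K : ℝ) ^ 2 := sq_nonneg _
    nlinarith [mul_nonneg hK2 hetaR]
  have h2 : 2 * ((K : ℝ) ^ 2 * Lip * (eta : ℝ)) < 1 := by linarith
  have hρmin : (1 - Real.sqrt (1 - 2 * ((K : ℝ) ^ 2 * Lip * (eta : ℝ)))) / ((K : ℝ) * Lip) ≤ (rE : ℝ) :=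
    (kantorovich_radius_le hKposR hLpos hetaR h2.le).trans hrEge
  have hρmax : (rE : ℝ) < 1 / ((K : ℝ) * Lip) := by
    have hKL : (0 : ℝ) < (K : ℝ) * Lip := mul_pos hKposR hLpos
    rw [lt_div_iff₀ hKL]
    have hrE0 : (0 : ℝ) ≤ (rE : ℝ) := le_trans (by positivity) hrEge
    calc (rE : ℝ) * ((K : ℝ) * Lip) ≤ (rE : ℝ) * ((K : ℝ) * (Llip : ℝ)) := by
          exact mul_le_mul_of_nonneg_left (mul_le_mul_of_nonneg_left hLlip hKposR.le) hrE0
      _ = (rE : ℝ) * (K : ℝ) * (Llip : ℝ) := by ring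
      _ < 1 := hwin
  exact existsUnique_zero_of_kantorovich_window Φ hΦeq hG hKΦ hL hη hKposR hLpos h2 hρmin hρmax

/-! ### Appendix (cert-2 g4, same session): the QUADRATIC form of the row theorem — (h1)/(h2) discharged

For the sheet, `G(Ω) = AΩ + Q Ω Ω` is linear + quadratic (`A = 1 + ½ξ∂ − ∂²` part, `Q u v = a𝒰_u v′ − (Hu)·v`), so differentiability
everywhere and the global Lipschitz bound of `DG` are automatic (`Literature.Analysis.Calculus.QuadraticMapKantorovich`): the MODEL
ASSEMBLY now only has to supply the algebraic splitting of `DG(x̄) = A + Q x̄ + Q.flip x̄` and ONE bilinear estimate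
`‖Q u v‖_{X*} ≤ M‖u‖_E‖v‖_E` with `2M ≤ Llip` (PRICE (C4): `M = 2[2√2/L + 2a(π/(4L))^{1/2}]`, `L_lip = 2M`). -/

/-- **The row's sentence for a quadratic map** `G u = g₀ + A u + Q u u` (the sheet's shape): as `existsUnique_zero_of_row`, but the
hypotheses «`HasFDerivAt` everywhere» and «`‖G′x − G′x̄‖ ≤ L‖x − x̄‖`» are REPLACED by the bilinear bound `‖Q u v‖ ≤ M‖u‖‖v‖` with
`2M ≤ Llip`, and the splitting hypothesis reads `(A + Q x̄ + Q.flip x̄) u = B u − ∑ ℓᵢ(u) fᵢ − J (R u)`.  Conclusion: exactly one zero of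
`G` in the closed `E`-ball of radius `rE` about `x̄`. (MODEL; interval data and the instantiation are hypotheses.) [folklore] -/
theorem existsUnique_zero_of_row_quadratic (g₀ : StrongDual ℝ E) (A : E →L[ℝ] StrongDual ℝ E)
    (Q : E →L[ℝ] E →L[ℝ] StrongDual ℝ E) (xbar : E) {M : ℝ} (hMpos : 0 < M)
    (hM : ∀ u v, ‖Q u v‖ ≤ M * ‖u‖ * ‖v‖)
    {B : E →L[ℝ] E →L[ℝ] ℝ}
    (S : StrongDual ℝ E →L[ℝ] E) (hBS : ∀ φ, B (S φ) = φ) (hSB : ∀ u, S (B u) = u)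
    {Kone : ℝ} (hS : ∀ φ, ‖S φ‖ ≤ Kone * ‖φ‖)
    (f : ι → StrongDual ℝ E) (ℓ : ι → E →L[ℝ] ℝ) (Ncap : Matrix ι ι ℝ)
    (hN₁ : (1 - capMatrix f (fun i => (ℓ i).comp S)) * Ncap = 1)
    (hN₂ : Ncap * (1 - capMatrix f (fun i => (ℓ i).comp S)) = 1)
    (z : ι → E) (hz : ∀ j u, B u (z j) = ℓ j u) {ΛE : ℝ} (hΛE : 0 ≤ ΛE)
    (hpE : ∀ w : ι → ℝ, ‖∑ i, (Ncap *ᵥ (Matrix.gram ℝ z *ᵥ w)) i • S (f i)‖ ^ 2 ≤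
      ΛE * (w ⬝ᵥ (Matrix.gram ℝ z *ᵥ w)))
    (J : W →L[ℝ] StrongDual ℝ E) {Ktwo : ℝ} (hSJ : ∀ g, ‖S (J g)‖ ≤ Ktwo * ‖g‖) (hKtwo : 0 ≤ Ktwo)
    (arep : ι → W) (ha : ∀ j g, ℓ j (S (J g)) = inner ℝ (arep j) g) {ΛW : ℝ} (hΛW : 0 ≤ ΛW)
    (hpW : ∀ w : ι → ℝ, ‖∑ i, (Ncap *ᵥ (Matrix.gram ℝ arep *ᵥ w)) i • S (f i)‖ ^ 2 ≤
      ΛW * (w ⬝ᵥ (Matrix.gram ℝ arep *ᵥ w)))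
    (R : E →L[ℝ] W) {ε : ℝ} (hR : ∀ u, ‖R u‖ ≤ ε * ‖u‖) (hε : 0 ≤ ε)
    (hD : ∀ u, (A + Q xbar + Q.flip xbar) u = B u - ∑ i, ℓ i u • f i - J (R u))
    -- the bounds by the row's literals
    (hKNstar : Kone + Real.sqrt ΛE ≤ (KNstar : ℝ)) (hKNw : Ktwo + Real.sqrt ΛW ≤ (KNw : ℝ))
    (hεN : ε ≤ (epsN : ℝ)) (hLlip : 2 * M ≤ (Llip : ℝ)) (hη : ‖g₀ + A xbar + Q xbar xbar‖ ≤ (eta : ℝ)) :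
    ∃ x ∈ closedBall xbar (rE : ℝ), g₀ + A x + Q x x = 0 ∧
      ∀ y ∈ closedBall xbar (rE : ℝ), g₀ + A y + Q y y = 0 → y = x :=
  existsUnique_zero_of_row (G := fun v : E => g₀ + A v + Q v v) (G' := fun w : E => A + Q w + Q.flip w)
    (hasFDerivAt_quadraticMap' g₀ A Q) S hBS hSB hS f ℓ Ncap hN₁ hN₂ z hz hΛE hpE J hSJ hKtwo arep ha hΛW
    hpW R hR hε hD (fun x => norm_fderiv_quadraticMap_sub_le A Q hMpos.le hM x xbar) (by positivity) hKNstar hKNw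
    hεN hLlip hη

end CertificateViscousSheetR
end Summit.NavierStokesRegularity.OSWSelfSimilar

end
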